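import Summits.QuantumFields.YangMills.Theorems.BalabanUVNodesN12FlatOneLevelGramExact
import Summits.QuantumFields.YangMills.Theorems.BalabanUVNodesN12FlatLinAvgOntoPins
import Summits.QuantumFields.YangMills.Theorems.UnitScaleTiltProp7LinAvgOnto
import HarnessLib

/-!
# BalabanUVNodes ∕ N12 — (J-b) module H12a: THE COMB CORRECTION BY CENTRE SPIKES — from ANY right inverse of the straight `L•Q` to a right inverse of the TRUE one-step linearisation
# `Q^{(1)} = linAvg = L•Q − dλ̄` ([Balaban1985Averaging] (124)–(125), (62)), at bond-`ℓ²` cost `≤ 2·‖Y₀‖² + 8d·Σ_y ‖λ̄(Y₀)(y)‖²`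

Cell `pub-ymgap` (HUMAN RULINGS D-0062 ∕ D-0149), width seat `pub-ymgap-dag-n10-w1` g5 (modules H8∕H8b∕H9∕H10∕H11 of this session).  `--kind proof --supports stmt-QuantumFields-27364 --as helper`
(K1⁹, KEY MAP v2); count-neutral; THEOREMS ONLY (0 `def`, 0 `sorry`, 0 `instance`, 0 `notation`).

THE DEVICE.  UST's bridge identity `linAvg Y = L•QY − (λ̄(Y)(c₊) − λ̄(Y)(c₋))` (`BlockAveragingEMLLinearised.linAvg_eq_bondAvg_sub_grad_combMean`) and the pure-gauge rule
`linAvg (dψ) = ψ(emb c₊) − ψ(emb c₋)` (`linAvg_grad`) say: if `L•QY₀ = v` and `ψ` is ANY fine site function with `ψ(emb y) = λ̄(Y₀)(y)` at the block centres, then `Y := Y₀ + dψ` solves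
`linAvg Y = v`.  The cheapest `ψ` is the SPIKE `ψ = λ̄(Y₀)(y)` AT the centre `emb y` and `0` elsewhere: `dψ` lives on the `2d` bonds at each centre, so `Σ_b ‖Y(b)‖² ≤ 2Σ_b ‖Y₀(b)‖² +
8d·Σ_y ‖λ̄(Y₀)(y)‖²` — the comb correction costs only the `ℓ²` size of the comb means of `Y₀` (NO face-crossing, NO interpolation).  With `Y₀` the TENT right inverse of module H11 (pointwise
size `L^{−d}·|G′v|`) and UST's `norm_combMean_le_of_local` (`‖λ̄_Z(y)‖ ≤ (d+2)L·sup_{B(y)}‖Z‖`) this yields an `O(1)`-in-η-units, `L`- and volume-uniform right inverse of the true one-step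
linearisation (module H12b); THIS FILE is the algebra, for an ARBITRARY straight right inverse `Y₀`.

CONTENTS (ns `Summit.QuantumFields.YangMills.BalabanUVNodes.N12FlatLinAvgCombCorrection`).  §1 `linAvg_add_grad_spike` (the identity), ★★★ `linAvg_combCorrected_eq`
(`L•QY₀ = v ⟹ linAvg (Y₀ + dψ_{Y₀}) = v`).  §2 `sum_norm_sq_spike_eq` (`Σ_x ‖ψ x‖² = Σ_y ‖λ̄(Y₀)(y)‖²`), `sum_norm_sq_grad_le` (`Σ_b ‖ψ b₊ − ψ b₋‖² ≤ 4d·Σ_x ‖ψ x‖²`),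
★★★ `sum_norm_sq_combCorrected_le` (`Σ_b ‖Y(b)‖² ≤ 2Σ_b‖Y₀(b)‖² + 8d·Σ_y‖λ̄(Y₀)(y)‖²`), ★★★ `exists_linAvg_rightInverse_of_straight` (packaged: from `Y₀` with `L•QY₀ = v` to `Y` with
`linAvg Y = v` and that letter).

HONEST FRAMING.  Algebra + counting on the tree's own `linAvg`∕`combMean` at the FLAT configuration, one level, whole torus; no estimate of Bałaban's; the `ℓ²` size of the comb means (hence
print's (46) at one level) is NOT bounded here (module H12b); N12 ∕ N10 NOT discharged; K1⁹ NOT closed; count-neutral (typed 28∕28 · discharged 5∕27 unmoved); one finite 𝕋⁴ programme at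
fixed ε — R4 closes the conditional finite-𝕋⁴ rung `BalabanLadder.UV` only; the YM mass gap (Clay) is NOT proved by any of this; nothing continuum ∕ ℝ⁴ ∕ OS.
-/

noncomputable section
open scoped BigOperators Matrix.Norms.L2Operator
open Finset
namespace Summit.QuantumFields.YangMills.BalabanUVNodes.N12FlatLinAvgCombCorrection

open Literature.MathematicalPhysics.QuantumFieldTheory.Balaban1983to89
open LatticeFieldCalculus (bondAvg)
open BlockAveragingEMLLinearised (linAvg combMean linAvg_eq_bondAvg_sub_grad_combMean linAvg_grad)
open B10StarCount (shift_unshift unshift_shift shiftEquiv)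
open Summit.QuantumFields.YangMills.Theorems.Prop7LinAvgOnto (linAvg_add)
open Summit.QuantumFields.YangMills.Theorems.Prop7FlatCurlCurl (sum_bond_eq_sum_site_dir)
open Summit.QuantumFields.YangMills.Theorems.Prop7TrueLinLineBound (sum_site_eq_sum_blockSite)
open Summit.QuantumFields.YangMills.BalabanUVNodes.N12FlatOneLevelGramExact (blockSite_inj)
open Summit.QuantumFields.YangMills.BalabanUVNodes.N12FlatLinAvgOntoPins (emb_eq_blockSite)

variable {P : Params} {j : ℕ} {n : Type*}

/-! ## §1  The identity: spikes at the centres absorb the comb gradient -/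

section Identity

/-- **Centre spikes absorb the comb gradient**: for every fine site function `ψ` with `ψ(emb y) = λ̄(Y₀)(y)` at the block centres, `linAvg (Y₀ + dψ) = L•QY₀` (UST's
`linAvg_eq_bondAvg_sub_grad_combMean` + `linAvg_grad` + `linAvg_add`). [cite: Balaban1985Averaging, (124)-(125) p.36, (62) p.28] -/
theorem linAvg_add_grad_spike (Y₀ : PBond P j → Matrix n n ℂ) (ψ : Site P j → Matrix n n ℂ) (hψ : ∀ y : Site P (j + 1), ψ (emb y) = combMean Y₀ y) (c : PBond P (j + 1)) :
    linAvg (fun b => Y₀ b + (ψ b.tgt - ψ b.src)) c = ((P.L : ℕ) : ℂ) • bondAvg Y₀ c := by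
  rw [linAvg_add, linAvg_eq_bondAvg_sub_grad_combMean, linAvg_grad, hψ, hψ]
  abel

/-- ★★★ **FROM A RIGHT INVERSE OF THE STRAIGHT `L•Q` TO ONE OF THE TRUE LINEARISATION `linAvg`**: if `L•QY₀ = v` then, with the SPIKE `ψ(x) = λ̄(Y₀)(blockOf x)` at centres and `0` elsewhere,
`linAvg (Y₀ + dψ) = v`. [cite: Balaban1985Averaging, (124)-(125) p.36, (62) p.28; Balaban1985Variational, (45)-(46) p.285] -/
theorem linAvg_combCorrected_eq (hj : j + 1 ≤ P.m + P.K) (Y₀ : PBond P j → Matrix n n ℂ) (v : PBond P (j + 1) → Matrix n n ℂ)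
    (hY₀ : ∀ c, ((P.L : ℕ) : ℂ) • bondAvg Y₀ c = v c) (c : PBond P (j + 1)) :
    linAvg (fun b => Y₀ b + ((if b.tgt = emb (blockOf b.tgt) then combMean Y₀ (blockOf b.tgt) else 0) -
      (if b.src = emb (blockOf b.src) then combMean Y₀ (blockOf b.src) else 0))) c = v c := by
  rw [← hY₀ c]
  exact linAvg_add_grad_spike Y₀ (fun x => if x = emb (blockOf x) then combMean Y₀ (blockOf x) else 0)
    (fun y => by simp only [Site.blockOf_emb hj, if_true]) c

end Identity

/-! ## §2  The cost of the spikes -/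

section Cost

variable [Fintype n] [DecidableEq n]

/-- **The spikes carry exactly the comb means**: `Σ_x ‖ψ(x)‖² = Σ_y ‖λ̄(Y₀)(y)‖²` (one centre per block; `emb y = blockSite y ((L−1)∕2,…)`). [cite: Balaban1987RG1, (0.1) p.251] -/
theorem sum_norm_sq_spike_eq (hj : j + 1 ≤ P.m + P.K) (Λ : Site P (j + 1) → Matrix n n ℂ) :
    ∑ x : Site P j, ‖(if x = emb (blockOf x) then Λ (blockOf x) else 0)‖ ^ 2 = ∑ y : Site P (j + 1), ‖Λ y‖ ^ 2 := by
  rw [sum_site_eq_sum_blockSite hj]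
  refine Finset.sum_congr rfl fun y _ => ?_
  have hn : ∀ (p : Prop) [Decidable p] (A : Matrix n n ℂ), ‖(if p then A else (0 : Matrix n n ℂ))‖ ^ 2 = if p then ‖A‖ ^ 2 else 0 := by
    intro p _ A; split_ifs <;> simp
  simp only [Site.blockOf_blockSite hj, hn]
  have hiff : ∀ r : Fin P.d → Fin P.L, Site.blockSite y r = emb y ↔ r = fun _ => ⟨(P.L - 1) / 2, by have := P.hL.2; omega⟩ := fun r => by
    rw [emb_eq_blockSite]
    exact ⟨fun h => (blockSite_inj hj h).2, fun h => by rw [h]⟩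
  simp only [hiff, Finset.sum_ite_eq', Finset.mem_univ, if_true]

/-- **A gradient costs at most `4d` times its potential in `ℓ²`**: `Σ_b ‖ψ(b₊) − ψ(b₋)‖² ≤ 4d·Σ_x ‖ψ(x)‖²` (each site is the source of `d` bonds and the target of `d` bonds). [folklore] -/
theorem sum_norm_sq_grad_le (ψ : Site P j → Matrix n n ℂ) :
    ∑ b : PBond P j, ‖ψ b.tgt - ψ b.src‖ ^ 2 ≤ 4 * P.d * ∑ x : Site P j, ‖ψ x‖ ^ 2 := by
  have hpt : ∀ b : PBond P j, ‖ψ b.tgt - ψ b.src‖ ^ 2 ≤ 2 * ‖ψ b.tgt‖ ^ 2 + 2 * ‖ψ b.src‖ ^ 2 := fun b => by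
    have h := norm_sub_le (ψ b.tgt) (ψ b.src)
    nlinarith [norm_nonneg (ψ b.tgt - ψ b.src), norm_nonneg (ψ b.tgt), norm_nonneg (ψ b.src), sq_nonneg (‖ψ b.tgt‖ - ‖ψ b.src‖)]
  have hsrc : ∑ b : PBond P j, ‖ψ b.src‖ ^ 2 = P.d * ∑ x : Site P j, ‖ψ x‖ ^ 2 := by
    rw [sum_bond_eq_sum_site_dir]
    simp only [Finset.sum_const, Finset.card_univ, Fintype.card_fin, nsmul_eq_mul]
    rw [Finset.mul_sum]
  have htgt : ∑ b : PBond P j, ‖ψ b.tgt‖ ^ 2 = P.d * ∑ x : Site P j, ‖ψ x‖ ^ 2 := by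
    rw [sum_bond_eq_sum_site_dir]
    have h1 : ∀ x : Site P j, ∑ μ : Fin P.d, ‖ψ (PBond.tgt ⟨x, μ⟩)‖ ^ 2 = ∑ μ : Fin P.d, ‖ψ (x.shift μ)‖ ^ 2 := fun x => rfl
    simp only [h1]
    rw [Finset.sum_comm]
    have h2 : ∀ μ : Fin P.d, ∑ x : Site P j, ‖ψ (x.shift μ)‖ ^ 2 = ∑ x : Site P j, ‖ψ x‖ ^ 2 := fun μ =>
      Equiv.sum_comp (shiftEquiv μ) (fun x => ‖ψ x‖ ^ 2)
    simp only [h2, Finset.sum_const, Finset.card_univ, Fintype.card_fin, nsmul_eq_mul]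
  calc ∑ b : PBond P j, ‖ψ b.tgt - ψ b.src‖ ^ 2 ≤ ∑ b : PBond P j, (2 * ‖ψ b.tgt‖ ^ 2 + 2 * ‖ψ b.src‖ ^ 2) := Finset.sum_le_sum fun b _ => hpt b
    _ = 2 * ∑ b : PBond P j, ‖ψ b.tgt‖ ^ 2 + 2 * ∑ b : PBond P j, ‖ψ b.src‖ ^ 2 := by rw [Finset.sum_add_distrib, Finset.mul_sum, Finset.mul_sum]
    _ = 4 * P.d * ∑ x : Site P j, ‖ψ x‖ ^ 2 := by rw [hsrc, htgt]; ring

/-- ★★★ **THE COST OF THE COMB CORRECTION**: `Σ_b ‖Y₀(b) + dψ(b)‖² ≤ 2·Σ_b ‖Y₀(b)‖² + 8d·Σ_y ‖λ̄(Y₀)(y)‖²` for the centre spikes `ψ`.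
[cite: Balaban1985Averaging, (62) p.28; Balaban1985Variational, (45)-(46) p.285] -/
theorem sum_norm_sq_combCorrected_le (hj : j + 1 ≤ P.m + P.K) (Y₀ : PBond P j → Matrix n n ℂ) :
    ∑ b : PBond P j, ‖Y₀ b + ((if b.tgt = emb (blockOf b.tgt) then combMean Y₀ (blockOf b.tgt) else 0) -
        (if b.src = emb (blockOf b.src) then combMean Y₀ (blockOf b.src) else 0))‖ ^ 2 ≤
      2 * ∑ b : PBond P j, ‖Y₀ b‖ ^ 2 + 8 * P.d * ∑ y : Site P (j + 1), ‖combMean Y₀ y‖ ^ 2 := by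
  set ψ : Site P j → Matrix n n ℂ := fun x => if x = emb (blockOf x) then combMean Y₀ (blockOf x) else 0 with hψ
  have hpt : ∀ b : PBond P j, ‖Y₀ b + (ψ b.tgt - ψ b.src)‖ ^ 2 ≤ 2 * ‖Y₀ b‖ ^ 2 + 2 * ‖ψ b.tgt - ψ b.src‖ ^ 2 := fun b => by
    have h := norm_add_le (Y₀ b) (ψ b.tgt - ψ b.src)
    nlinarith [norm_nonneg (Y₀ b + (ψ b.tgt - ψ b.src)), norm_nonneg (Y₀ b), norm_nonneg (ψ b.tgt - ψ b.src), sq_nonneg (‖Y₀ b‖ - ‖ψ b.tgt - ψ b.src‖)]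
  have hgrad := sum_norm_sq_grad_le ψ
  have hspike : ∑ x : Site P j, ‖ψ x‖ ^ 2 = ∑ y : Site P (j + 1), ‖combMean Y₀ y‖ ^ 2 := sum_norm_sq_spike_eq hj (combMean Y₀)
  calc ∑ b : PBond P j, ‖Y₀ b + (ψ b.tgt - ψ b.src)‖ ^ 2 ≤ ∑ b : PBond P j, (2 * ‖Y₀ b‖ ^ 2 + 2 * ‖ψ b.tgt - ψ b.src‖ ^ 2) := Finset.sum_le_sum fun b _ => hpt b
    _ = 2 * ∑ b : PBond P j, ‖Y₀ b‖ ^ 2 + 2 * ∑ b : PBond P j, ‖ψ b.tgt - ψ b.src‖ ^ 2 := by rw [Finset.sum_add_distrib, Finset.mul_sum, Finset.mul_sum]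
    _ ≤ 2 * ∑ b : PBond P j, ‖Y₀ b‖ ^ 2 + 2 * (4 * P.d * ∑ x : Site P j, ‖ψ x‖ ^ 2) := by linarith
    _ = 2 * ∑ b : PBond P j, ‖Y₀ b‖ ^ 2 + 8 * P.d * ∑ y : Site P (j + 1), ‖combMean Y₀ y‖ ^ 2 := by rw [hspike]; ring

/-- ★★★ **PACKAGED**: from ANY straight right-inverse datum `Y₀` (`L•QY₀ = v`) to a solution `Y` of the TRUE linearised one-step constraint `linAvg Y = v` with
`Σ_b ‖Y(b)‖² ≤ 2·Σ_b ‖Y₀(b)‖² + 8d·Σ_y ‖λ̄(Y₀)(y)‖²`. [cite: Balaban1985Averaging, (124)-(125) p.36, (62) p.28; Balaban1985Variational, (45)-(46) p.285] -/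
theorem exists_linAvg_solution_of_straight (hj : j + 1 ≤ P.m + P.K) (Y₀ : PBond P j → Matrix n n ℂ) (v : PBond P (j + 1) → Matrix n n ℂ)
    (hY₀ : ∀ c, ((P.L : ℕ) : ℂ) • bondAvg Y₀ c = v c) :
    ∃ Y : PBond P j → Matrix n n ℂ, (∀ c, linAvg Y c = v c) ∧
      ∑ b, ‖Y b‖ ^ 2 ≤ 2 * ∑ b, ‖Y₀ b‖ ^ 2 + 8 * P.d * ∑ y : Site P (j + 1), ‖combMean Y₀ y‖ ^ 2 :=
  ⟨_, linAvg_combCorrected_eq hj Y₀ v hY₀, sum_norm_sq_combCorrected_le hj Y₀⟩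

end Cost

end Summit.QuantumFields.YangMills.BalabanUVNodes.N12FlatLinAvgCombCorrection
end
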